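import Literature.NumberTheory.Automorphic.RankinSelbergLocalLFactorCounterexample
import Literature.NumberTheory.Automorphic.RankinSelbergLocalTwistProofs
import HarnessLib

/-!
# The local Rankin–Selberg functional equation and `ε`-factor in rank zero (`GL_n × GL_0`), proved

Companion to `RankinSelbergLocal` (Jacquet–Piatetski-Shapiro–Shalika 1983, §2, Thm. 2.7;
Cogdell, *Analytic theory of `L`-functions for `GL_n`*, in Bernstein–Gelbart (eds.), §3.1,
Thms. 3.1–3.2), to `RankinSelbergLocalUniqueness` (uniqueness halves, proved), to
`RankinSelbergLocalGammaCounterexample` (the named fact `existsUnique_hasRSGamma` is FALSE at the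
zero measure `ν = 0`, which it admits because its invariance/positivity hypotheses were section
instances not captured by the `def`) and to `RankinSelbergLocalLFactorCounterexample` (the
same for the `L`-factor, and the rank-zero `L`-factor `P = 1`: `rsZeta_fin_zero`,
`hasRSLFactor_one_fin_zero`, reused here; cf. also `RankinSelbergLocalUnramified`).

The predicate `HasRSGamma hmn π π' ψ μ ν γ` of `RankinSelbergLocal` (the local functional equation
`Ψ_{n-m-1}(1 - s; ρ(w_{n,m}) W̃, W̃') = ω_{π'}(-1)^{n-1} γ Ψ(s; W, W')`) is stated for
`hmn : m < n`, so it includes the degenerate rank `m = 0`, where `GL_0(F) = U_0 = 1`,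
`GL_0 ⧸ U_0` is a point, and the source (JPSS 1983, §2: `1 ≤ m < n`) says nothing. This file
settles the functional equation in that rank, by computation, for every `n ≥ 1`:

* `weylNM_zero`: `w_{n,0} = w_n` (the block involution `diag(1_0, rev)` transported along
  `finBlockEquiv` is `Fin.rev`, `permCongr_finBlockEquiv_zero`); with `ᵗw_n⁻¹ = w_n`
  (`glTransposeInv_weylLong` of `RankinSelbergLocalTwistProofs`) this gives
  `tildeFn_weylNM_zero`: `W̃(w_{n,0}) = W(w_n w_n) = W(1)`; `lowerShear_zero`: the shear `u(x)`,
  `x ∈ M_{(n-1)×0}`, is `1`.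
* `rsZetaTilde_rank_zero`: the contragredient side `Ψ_{n-1}(s; ρ(w_{n,0}) W̃, W̃')` equals
  `ν(pt) · W(1) W'(1)` for every `s` and EVERY measure `μ` on `F` — the shear variables range
  over the one-point type `Fin (n-1) → Fin 0 → F`, on which `Measure.pi` is a Dirac mass
  (`Measure.pi_empty_univ`) — i.e. it equals the right side `Ψ(s; W, W') = ν(pt) · W(1) W'(1)`
  (`rsZeta_fin_zero`).
* `hasRSGamma_one_rank_zero`: `γ = 1` satisfies the functional equation for ALL `π, π', ψ, μ, ν`
  (`ω_{π'} = 1` on the trivial centre, `hasCentralCharacter_one_rank_zero`);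
  `hasRSGamma_rank_zero_of_measureReal_eq_zero`: if `ν(pt) = 0` in `ℝ`, every `γ` does.
* Consequences (`π` `ψ`-generic, `π'` `ψ⁻¹`-generic): `existsUnique_hasRSGamma_rank_zero`
  (`∃! γ` for `ν(pt) ≠ 0`, via `HasRSGamma.existsUnique_of_exists` and the `L`-polynomial
  `P = 1` of `hasRSLFactor_one_fin_zero`), `hasRSGamma_rank_zero_iff` (`γ = 1`), the dichotomy
  `existsUnique_hasRSGamma_rank_zero_iff` (`∃! γ ↔ ν(pt) ≠ 0` in `ℝ`, i.e. `0 < ν(pt) < ∞`;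
  complements `not_existsUnique_hasRSGamma_zero_measure`), and the NAMED FACT in rank zero:
  `existsUnique_hasRSGamma_of_rank_zero` discharges `existsUnique_hasRSGamma hn π π' ψ ν μ`
  (`m = 0`) for every `ν` with `0 < ν(pt) < ∞` and every `μ` — in particular under the intended
  hypotheses `[IsFiniteMeasureOnCompacts ν] [ν.IsOpenPosMeasure]`
  (`existsUnique_hasRSGamma_of_rank_zero_of_isOpenPosMeasure`), the `m = 0` instance of the
  corrected fact announced in `RankinSelbergLocalGammaCounterexample`.

* The `ε`-factor in rank zero: the NAMED FACT `hasRSEpsilon_ne_zero` of `RankinSelbergLocal`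
  holds for `m = 0` and EVERY `ν`, `μ` (`hasRSEpsilon_ne_zero_of_rank_zero`: with `ν(pt) ≠ 0` the
  `γ` of an `ε`-datum is `1 ≠ 0 · T^a L̃/L`; with `ν(pt) = 0` in `ℝ` there is no `L`-polynomial,
  `not_hasRSLFactor_rank_zero_of_measureReal_eq_zero`); and, granting the genericity of the
  contragredients (Gelfand–Kazhdan, not in the tree), `(e, a) = (1, 0)` is the unique `ε`-datum
  (`hasRSEpsilon_one_zero_rank_zero`, `existsUnique_hasRSEpsilon_rank_zero`,
  `hasRSEpsilon_rank_zero_iff`).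

So in rank zero `L(s, π × π') = 1`, `γ(s, π × π', ψ) = 1`, `ε(s, π × π', ψ) = 1`; the genuine
content of JPSS Thm. 2.7 is `1 ≤ m < n` and stays in the named facts. No definitions, no named
facts are introduced (D-0026).

## References

* H. Jacquet, I. I. Piatetski-Shapiro, J. Shalika, *Rankin–Selberg convolutions*, Amer. J. Math.
  105 (1983), 367–464, §2, Thm. 2.7 (iii) [JacquetPiatetskiShapiroShalika1983].
* J. W. Cogdell, *Analytic theory of `L`-functions for `GL_n`*, in *An Introduction to the
  Langlands Program* (Bernstein–Gelbart, eds.), §3.1, Thm. 3.2 p. 194 (read: the local functional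
  equation `Ψ̃(1-s; ρ(w_{n,m}) W̃, W̃') = ω'(-1)^{n-1} γ(s, π × π', ψ) Ψ(s; W, W')`, `m < n`).
* Mathlib: `MeasureTheory.integral_const`, `MeasureTheory.Measure.pi_empty_univ`,
  `MeasureTheory.Measure.pi.instIsProbabilityMeasure`, `Equiv.permCongr_apply`.
-/

set_option autoImplicit false

open scoped NNReal
open MeasureTheory Polynomial Matrix
  Literature.NumberTheory.GaloisRepresentations.IsNonarchimedeanLocalField

noncomputable section

namespace Literature.NumberTheory.Automorphic

/-! ### Weyl elements and shears in rank zero -/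

section Weyl

variable {R : Type*} [CommRing R] {n : ℕ}

/-- For `m = 0` the block involution `diag(1_0, rev_{n-0})` of `Fin 0 ⊕ Fin (n - 0)`, transported
to `Fin n` along `finBlockEquiv`, is `Fin.rev`. [folklore] -/
theorem permCongr_finBlockEquiv_zero (h : 0 ≤ n) :
    (finBlockEquiv h).permCongr (Equiv.sumCongr (Equiv.refl (Fin 0)) Fin.revPerm) =
      Fin.revPerm := by
  ext i : 1
  obtain ⟨x, rfl⟩ := (finBlockEquiv h).surjective i
  rcases x with a | b
  · exact a.elim0
  · simp only [Equiv.permCongr_apply, Equiv.symm_apply_apply, Equiv.sumCongr_apply, Sum.map_inr,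
      Fin.revPerm_apply]
    apply Fin.ext
    rw [Fin.val_rev, coe_finBlockEquiv_inr, coe_finBlockEquiv_inr, Fin.val_rev]
    omega

variable (R) in
/-- **`w_{n,0} = w_n`**: in rank zero the Weyl element `diag(1_0, w_n)` of the functional equation
is the long Weyl element. [folklore] -/
theorem weylNM_zero (h : 0 ≤ n) : weylNM R h = weylLong n R := by
  unfold weylNM weylLong
  rw [permCongr_finBlockEquiv_zero]

/-- **`W̃(w_{n,0}) = W(1)`** over a topological field: `W̃(w_{n,0}) = W(w_n ᵗw_{n,0}⁻¹) =
W(w_n w_n) = W(1)` (`glTransposeInv_weylLong` of `RankinSelbergLocalTwistProofs`,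
`weylLong_mul_self` of `RankinSelbergLocalProofs`). [folklore] -/
theorem tildeFn_weylNM_zero {F : Type*} [Field F] [TopologicalSpace F] (W : GL (Fin n) F → ℂ)
    (h : 0 ≤ n) : tildeFn W (weylNM F h) = W 1 := by
  rw [tildeFn_apply, weylNM_zero, glTransposeInv_weylLong, weylLong_mul_self]

/-- In rank zero the shear matrix `X(x)`, `x ∈ M_{(n-1)×0}`, vanishes (it has no columns).
[folklore] -/
theorem lowerShearMatrix_zero (x : Fin (n - 0 - 1) → Fin 0 → R) : lowerShearMatrix n 0 x = 0 := by
  ext i j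
  exact lowerShearMatrix_apply_of_le i (Nat.zero_le _)

/-- In rank zero the unipotent shear `u(x) = 1 + X(x)` is `1`. [folklore] -/
theorem lowerShear_zero (x : Fin (n - 0 - 1) → Fin 0 → R) : lowerShear n 0 x = 1 :=
  Units.ext (by rw [coe_lowerShear, lowerShearMatrix_zero, add_zero, Units.val_one])

end Weyl

/-! ### The contragredient side of the functional equation in rank zero -/

section Integrals

variable {F : Type*} [Field F] [ValuativeRel F] [TopologicalSpace F] [IsNonarchimedeanLocalField F]
  {n : ℕ} [MeasurableSpace (GL (Fin 0) F ⧸ upperUnitriangular (Fin 0) F)]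
  (ν : Measure (GL (Fin 0) F ⧸ upperUnitriangular (Fin 0) F))

/-- **The modified zeta integral in rank zero**, on the contragredient side of the functional
equation: `Ψ_{n-1}(s; ρ(w_{n,0}) W̃, W̃') = ν(pt) · W(1) W'(1)` for every `s` and EVERY measure `μ`
on `F` — the shear variables `x ∈ M_{(n-1)×0}(F)` range over a point, `Measure.pi` of the empty
family is a Dirac mass (`Measure.pi_empty_univ`), `u(x) = 1`, `W̃(w_{n,0}) = W(1)` and
`W̃'(1) = W'(1)`; the outer integral over the point `GL_0 ⧸ U_0` is `rsZeta_fin_zero`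
(`ν(pt)` is read in `ℝ`, so it is `0` if `ν` is infinite). [folklore] -/
theorem rsZetaTilde_rank_zero (hn : 0 < n) [MeasurableSpace F] (μ : Measure F)
    (W : GL (Fin n) F → ℂ) (W' : GL (Fin 0) F → ℂ) (s : ℂ) :
    rsZetaTilde hn μ ν (fun g => tildeFn W (g * weylNM F hn.le)) (tildeFn W') s =
      (ν.real Set.univ : ℂ) * (W 1 * W' 1) := by
  haveI : IsProbabilityMeasure (Measure.pi fun _ : Fin 0 => μ) := ⟨Measure.pi_empty_univ _⟩
  have h1 : tildeFn W' 1 = W' 1 := by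
    rw [tildeFn_apply, Subsingleton.elim (weylLong 0 F * _) 1]
  rw [rsZetaTilde, rsZeta_fin_zero, h1]
  simp only [lowerShear_zero, mul_one, one_mul, tildeFn_weylNM_zero, integral_const,
    probReal_univ, one_smul]

end Integrals

/-! ### The functional equation in rank zero -/

section Gamma

variable {F : Type*} [Field F] [ValuativeRel F] [TopologicalSpace F] [IsNonarchimedeanLocalField F]
  {n : ℕ} {V : Type*} [AddCommGroup V] [Module ℂ V] {V' : Type*} [AddCommGroup V'] [Module ℂ V']
  [MeasurableSpace (GL (Fin 0) F ⧸ upperUnitriangular (Fin 0) F)]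
  (ν : Measure (GL (Fin 0) F ⧸ upperUnitriangular (Fin 0) F))
  (hn : 0 < n) (π : Representation ℂ (GL (Fin n) F) V) (π' : Representation ℂ (GL (Fin 0) F) V')
  (ψ : AddChar F Circle) [MeasurableSpace F] (μ : Measure F)

omit [ValuativeRel F] [TopologicalSpace F] [IsNonarchimedeanLocalField F]
  [MeasurableSpace (GL (Fin 0) F ⧸ upperUnitriangular (Fin 0) F)] [MeasurableSpace F] in
/-- Every representation of the trivial group `GL_0(F)` has the trivial central character.
[folklore] -/
theorem hasCentralCharacter_one_rank_zero : π'.HasCentralCharacter 1 := fun z => by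
  rw [Subsingleton.elim (z : GL (Fin 0) F) 1, map_one, MonoidHom.one_apply, Units.val_one,
    one_smul]
  rfl

/-- **`HasRSGamma … γ` in rank zero for a prescribed `γ`.** Every zeta integral of the pair is the
constant `c(W, W') = ν(pt) W(1) W'(1)` on both sides of the functional equation
(`rsZeta_fin_zero`, `rsZetaTilde_rank_zero`), and `ω_{π'} = 1`; so `γ` satisfies `HasRSGamma` as
soon as `C c = γ · C c` in `ℂ(T)` for all `W, W'`. Used with `γ = 1` (always) and with `ν(pt) = 0`
(every `γ`). [folklore] -/
theorem hasRSGamma_rank_zero_of_forall (γ : RatFunc ℂ)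
    (hγ : ∀ (W : GL (Fin n) F → ℂ) (W' : GL (Fin 0) F → ℂ),
      RatFunc.C ((ν.real Set.univ : ℂ) * (W 1 * W' 1)) =
        γ * RatFunc.C ((ν.real Set.univ : ℂ) * (W 1 * W' 1))) :
    HasRSGamma hn π π' ψ μ ν γ := by
  refine ⟨1, hasCentralCharacter_one_rank_zero π', fun Λ _ Λ' _ v v' => ?_⟩
  refine ⟨RatFunc.C ((ν.real Set.univ : ℂ) *
      (whittakerModel π Λ v 1 * whittakerModel π' Λ' v' 1)),
    RatFunc.C ((ν.real Set.univ : ℂ) * (whittakerModel π Λ v 1 * whittakerModel π' Λ' v' 1)),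
    ⟨0, fun s _ => ?_⟩, ⟨0, fun s _ => ?_⟩, ?_⟩
  · rw [rsZeta_fin_zero, evalAtQ, RatFunc.eval_C, RingHom.id_apply]
  · dsimp only
    rw [rsZetaTilde_rank_zero, evalAtQ, RatFunc.eval_C, RingHom.id_apply]
  · rw [MonoidHom.one_apply, Units.val_one, one_pow, RatFunc.C.map_one, one_mul]
    exact hγ _ _

/-- **The local functional equation in rank zero holds with `γ = 1`**, for every `π`, `π'`, `ψ`,
`μ`, `ν` and `n ≥ 1`: both sides equal `ν(pt) W(1) W'(1)` and `ω_{π'}(-1)^{n-1} = 1`. In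
particular `HasRSGamma` is satisfiable by honest (non-zero) measures. [folklore] -/
theorem hasRSGamma_one_rank_zero : HasRSGamma hn π π' ψ μ ν 1 :=
  hasRSGamma_rank_zero_of_forall ν hn π π' ψ μ 1 fun _ _ => by rw [one_mul]

/-- If `ν(pt) = 0` in `ℝ` (i.e. `ν = 0` or `ν(pt) = ∞`), every `γ` satisfies the rank-zero
functional equation (all zeta integrals vanish); cf. `hasRSGamma_zero_measure` of
`RankinSelbergLocalGammaCounterexample` for `ν = 0` in every rank. [folklore] -/
theorem hasRSGamma_rank_zero_of_measureReal_eq_zero (hν : ν.real Set.univ = 0) (γ : RatFunc ℂ) :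
    HasRSGamma hn π π' ψ μ ν γ :=
  hasRSGamma_rank_zero_of_forall ν hn π π' ψ μ γ fun _ _ => by
    rw [hν, Complex.ofReal_zero, zero_mul, map_zero, mul_zero]

/-- **Existence and uniqueness of the `γ`-factor in rank zero** (`π` `ψ`-generic,
`π'` `ψ⁻¹`-generic — so `V' ≠ 0`, `IsGeneric.nontrivial` — and `ν(pt) ≠ 0` in `ℝ`): `γ = 1` exists
(`hasRSGamma_one_rank_zero`) and is unique (`HasRSGamma.existsUnique_of_exists` of
`RankinSelbergLocalUniqueness`, fed with the `L`-polynomial `P = 1` of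
`hasRSLFactor_one_fin_zero`). [folklore] -/
theorem existsUnique_hasRSGamma_rank_zero (hg : IsGeneric π ψ) (hg' : IsGeneric π' ψ⁻¹)
    (hν : ν.real Set.univ ≠ 0) : ∃! γ : RatFunc ℂ, HasRSGamma hn π π' ψ μ ν γ :=
  haveI : Nontrivial V' := hg'.nontrivial
  HasRSGamma.existsUnique_of_exists (hasRSLFactor_one_fin_zero hν hg hg')
    ⟨1, hasRSGamma_one_rank_zero ν hn π π' ψ μ⟩

/-- In rank zero, under the same hypotheses, **the `γ`-factor is `1`**: `HasRSGamma … γ ↔ γ = 1`.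
[folklore] -/
theorem hasRSGamma_rank_zero_iff (hg : IsGeneric π ψ) (hg' : IsGeneric π' ψ⁻¹)
    (hν : ν.real Set.univ ≠ 0) (γ : RatFunc ℂ) : HasRSGamma hn π π' ψ μ ν γ ↔ γ = 1 := by
  refine ⟨fun h => ?_, fun h => h ▸ hasRSGamma_one_rank_zero ν hn π π' ψ μ⟩
  exact (existsUnique_hasRSGamma_rank_zero ν hn π π' ψ μ hg hg' hν).unique h
    (hasRSGamma_one_rank_zero ν hn π π' ψ μ)

/-- **The rank-zero dichotomy for the functional equation** (`π`, `π'` generic):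
`∃! γ` holds iff `ν(pt) ≠ 0` in `ℝ` (i.e. `0 < ν(pt) < ∞`); otherwise every `γ` qualifies
(`hasRSGamma_rank_zero_of_measureReal_eq_zero`) and `0 ≠ 1` are two of them. [folklore] -/
theorem existsUnique_hasRSGamma_rank_zero_iff (hg : IsGeneric π ψ) (hg' : IsGeneric π' ψ⁻¹) :
    (∃! γ : RatFunc ℂ, HasRSGamma hn π π' ψ μ ν γ) ↔ ν.real Set.univ ≠ 0 := by
  refine ⟨fun ⟨γ, _, huniq⟩ hν => ?_, existsUnique_hasRSGamma_rank_zero ν hn π π' ψ μ hg hg'⟩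
  have h0 := huniq 0 (hasRSGamma_rank_zero_of_measureReal_eq_zero ν hn π π' ψ μ hν 0)
  have h1 := huniq 1 (hasRSGamma_rank_zero_of_measureReal_eq_zero ν hn π π' ψ μ hν 1)
  exact zero_ne_one (h0.trans h1.symm)

/-- **The named fact `existsUnique_hasRSGamma` of `RankinSelbergLocal` holds in rank zero** for
every measure `ν` on the point `GL_0 ⧸ U_0` with `ν(pt) ≠ 0` in `ℝ` and every `μ` (at `ν = 0` it
fails: `not_existsUnique_hasRSGamma_zero_measure` of `RankinSelbergLocalGammaCounterexample`);
of the fact's hypotheses only the genericity of `π` and `π'` is used — irreducibility,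
admissibility and the continuity of `ψ` are not needed in rank zero. [folklore] -/
theorem existsUnique_hasRSGamma_of_rank_zero (hν : ν.real Set.univ ≠ 0) :
    existsUnique_hasRSGamma hn π π' ψ ν μ :=
  fun _ _ hg hg' _ => existsUnique_hasRSGamma_rank_zero ν hn π π' ψ μ hg hg' hν

/-- **The corrected fact in rank zero.** With the measure hypotheses intended by
`RankinSelbergLocal` (and announced for the corrected statement in
`RankinSelbergLocalGammaCounterexample`) — `ν` finite on compacts and positive on opens, i.e.
`0 < ν(pt) < ∞` on the (compact, non-empty) point `GL_0 ⧸ U_0` (so `IsFiniteMeasure ν` and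
`NeZero ν`, whence `ν.real univ ≠ 0` by Mathlib's `MeasureTheory.measureReal_univ_ne_zero`) — the
local functional equation of `GL_n × GL_0` has the unique `γ`-factor `γ = 1`: the named fact
`existsUnique_hasRSGamma` holds for `m = 0`. [folklore] -/
theorem existsUnique_hasRSGamma_of_rank_zero_of_isOpenPosMeasure [IsFiniteMeasureOnCompacts ν]
    [ν.IsOpenPosMeasure] : existsUnique_hasRSGamma hn π π' ψ ν μ :=
  existsUnique_hasRSGamma_of_rank_zero ν hn π π' ψ μ measureReal_univ_ne_zero

end Gamma

/-! ### The `ε`-factor in rank zero -/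

section Epsilon

variable {F : Type*} [Field F] [ValuativeRel F] [TopologicalSpace F] [IsNonarchimedeanLocalField F]
  {n : ℕ} {V : Type*} [AddCommGroup V] [Module ℂ V] {V' : Type*} [AddCommGroup V'] [Module ℂ V']
  [MeasurableSpace (GL (Fin 0) F ⧸ upperUnitriangular (Fin 0) F)]
  (ν : Measure (GL (Fin 0) F ⧸ upperUnitriangular (Fin 0) F))
  (hn : 0 < n) (π : Representation ℂ (GL (Fin n) F) V) (π' : Representation ℂ (GL (Fin 0) F) V')
  (ψ : AddChar F Circle) [MeasurableSpace F] (μ : Measure F)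

omit [MeasurableSpace F] in
/-- If `ν(pt) = 0` in `ℝ` (`ν = 0` or `ν(pt) = ∞`), no polynomial is an `L`-polynomial in rank
zero: all zeta integrals `ν(pt) W(1) W'(1)` vanish, so clause (b) of `HasRSLFactor` would make
`1/P(q^{-s})` vanish (`HasRSLFactor.exists_ratFunc_ne_zero`); cf. `not_hasRSLFactor_zero_measure`.
[folklore] -/
theorem not_hasRSLFactor_rank_zero_of_measureReal_eq_zero (hν : ν.real Set.univ = 0) (P : ℂ[X]) :
    ¬ HasRSLFactor hn π π' ψ ν P := by
  intro h
  obtain ⟨k, Λ, Λ', v, v', Q, -, -, -, hb⟩ := h.2.2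
  have hR : ∀ i : Fin k, EqOnRightHalfPlane (residueFieldCard F)
      (rsZeta hn ν (whittakerModel π (Λ i) (v i)) (whittakerModel π' (Λ' i) (v' i))) 0 :=
    fun i => ⟨0, fun s _ => by
      rw [rsZeta_fin_zero, hν, Complex.ofReal_zero, zero_mul, evalAtQ, RatFunc.eval_zero]⟩
  obtain ⟨i, hi⟩ := h.exists_ratFunc_ne_zero hb hR
  exact hi rfl

/-- In rank zero with `ν(pt) ≠ 0` in `ℝ` and `π`, `π'` generic, **the constant `e` of any
`ε`-datum is non-zero**: its `γ = e T^a · L̃/L` must be the `γ`-factor `1`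
(`hasRSGamma_rank_zero_iff`), while `e = 0` gives `γ = 0`. [folklore] -/
theorem hasRSEpsilon_fst_ne_zero_of_rank_zero (hg : IsGeneric π ψ) (hg' : IsGeneric π' ψ⁻¹)
    (hν : ν.real Set.univ ≠ 0) {e : ℂ} {a : ℤ} (h : HasRSEpsilon hn π π' ψ μ ν e a) : e ≠ 0 := by
  rintro rfl
  obtain ⟨P, Pt, -, -, hγ⟩ := h
  have h1 := (hasRSGamma_rank_zero_iff ν hn π π' ψ μ hg hg' hν _).1 hγ
  rw [tateEpsilonRat_zero_left, zero_mul, zero_div] at h1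
  exact zero_ne_one h1

/-- **The named fact `hasRSEpsilon_ne_zero` of `RankinSelbergLocal` holds in rank zero**, for
EVERY `ν` and `μ`: if `ν(pt) ≠ 0` in `ℝ` by `hasRSEpsilon_fst_ne_zero_of_rank_zero`, and
otherwise vacuously, `HasRSEpsilon` requiring an `L`-polynomial
(`not_hasRSLFactor_rank_zero_of_measureReal_eq_zero`). Only the genericity hypotheses of the fact
are used. [folklore] -/
theorem hasRSEpsilon_ne_zero_of_rank_zero :
    hasRSEpsilon_ne_zero (hmn := hn) (π := π) (π' := π') (ψ := ψ) (ν := ν) (μ := μ) := by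
  intro _ _ _ _ hg hg' _ e a h
  by_cases hν : ν.real Set.univ = 0
  · obtain ⟨P, -, hP, -, -⟩ := h
    exact (not_hasRSLFactor_rank_zero_of_measureReal_eq_zero ν hn π π' ψ hν P hP).elim
  · exact hasRSEpsilon_fst_ne_zero_of_rank_zero ν hn π π' ψ μ hg hg' hν h

omit [MeasurableSpace (GL (Fin 0) F ⧸ upperUnitriangular (Fin 0) F)] [MeasurableSpace F] in
/-- `ε = 1 · T⁰` with trivial `L`-factors gives the `γ`-factor `1`:
`tateEpsilonRat 1 0 * rsLRatDual F 1 / rsLRat 1 = 1`. [folklore] -/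
theorem tateEpsilonRat_one_zero_mul_div : tateEpsilonRat 1 0 * rsLRatDual F 1 / rsLRat 1 = 1 := by
  rw [tateEpsilonRat, zpow_zero, mul_one, map_one, rsLRatDual, map_one, inv_one, rsLRat, map_one,
    inv_one, mul_one, div_one]

/-- **`ε(s, π × π', ψ) = 1` in rank zero.** If `ν(pt) ≠ 0` in `ℝ`, `π` is `ψ`-generic, `π'` is
`ψ⁻¹`-generic, and the contragredients `π̃`, `π̃'` are `ψ⁻¹`-, `ψ`-generic (for `GL_n`, `n ≥ 2`,
the genericity of `π̃` is Gelfand–Kazhdan's theorem `π̃ ≅ π^ι`, not proved in the tree, hence a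
hypothesis here), then the monomial data `(e, a) = (1, 0)` satisfy `HasRSEpsilon`: both
`L`-polynomials are `1` (`hasRSLFactor_one_fin_zero`) and `γ = 1` (`hasRSGamma_one_rank_zero`).
[folklore] -/
theorem hasRSEpsilon_one_zero_rank_zero (hν : ν.real Set.univ ≠ 0) (hg : IsGeneric π ψ)
    (hg' : IsGeneric π' ψ⁻¹) (hgc : IsGeneric π.contragredientRep ψ⁻¹)
    (hgc' : IsGeneric π'.contragredientRep ψ⁻¹⁻¹) : HasRSEpsilon hn π π' ψ μ ν 1 0 := by
  refine ⟨1, 1, hasRSLFactor_one_fin_zero hν hg hg', hasRSLFactor_one_fin_zero hν hgc hgc', ?_⟩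
  rw [tateEpsilonRat_one_zero_mul_div]
  exact hasRSGamma_one_rank_zero ν hn π π' ψ μ

/-- Under the same hypotheses, **`(e, a) = (1, 0)` is the unique `ε`-datum in rank zero**
(`HasRSEpsilon.existsUnique_of_exists` of `RankinSelbergLocalUniqueness`; `V' ≠ 0` by
`IsGeneric.nontrivial`). [folklore] -/
theorem existsUnique_hasRSEpsilon_rank_zero (hν : ν.real Set.univ ≠ 0) (hg : IsGeneric π ψ)
    (hg' : IsGeneric π' ψ⁻¹) (hgc : IsGeneric π.contragredientRep ψ⁻¹)
    (hgc' : IsGeneric π'.contragredientRep ψ⁻¹⁻¹) :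
    ∃! ea : ℂ × ℤ, HasRSEpsilon hn π π' ψ μ ν ea.1 ea.2 :=
  haveI : Nontrivial V' := hg'.nontrivial
  HasRSEpsilon.existsUnique_of_exists
    ⟨1, 0, one_ne_zero, hasRSEpsilon_one_zero_rank_zero ν hn π π' ψ μ hν hg hg' hgc hgc'⟩

/-- Under the same hypotheses, `HasRSEpsilon … e a ↔ (e, a) = (1, 0)` in rank zero. [folklore] -/
theorem hasRSEpsilon_rank_zero_iff (hν : ν.real Set.univ ≠ 0) (hg : IsGeneric π ψ)
    (hg' : IsGeneric π' ψ⁻¹) (hgc : IsGeneric π.contragredientRep ψ⁻¹)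
    (hgc' : IsGeneric π'.contragredientRep ψ⁻¹⁻¹) (e : ℂ) (a : ℤ) :
    HasRSEpsilon hn π π' ψ μ ν e a ↔ e = 1 ∧ a = 0 := by
  refine ⟨fun h => ?_, ?_⟩
  · have h1 := (existsUnique_hasRSEpsilon_rank_zero ν hn π π' ψ μ hν hg hg' hgc hgc').unique
      (y₁ := (e, a)) (y₂ := (1, 0)) h (hasRSEpsilon_one_zero_rank_zero ν hn π π' ψ μ hν hg hg' hgc hgc')
    exact Prod.ext_iff.1 h1
  · rintro ⟨rfl, rfl⟩
    exact hasRSEpsilon_one_zero_rank_zero ν hn π π' ψ μ hν hg hg' hgc hgc'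

end Epsilon

end Literature.NumberTheory.Automorphic
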